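import Summits.CriticalPhenomena.PercolationContinuityZ3.Theorems.PercAnnulusCrossingIICInwardExploration
import Summits.CriticalPhenomena.PercolationContinuityZ3.Theorems.PercAnnulusCrossingIICAnnulusNonUniqueness
import HarnessLib

/-!
# Kesten–Basu–Sapozhnikov IIC scheme in boxes, XII: the inward link holds outside annulus non-uniqueness (lane RSW3, p1 gen 3)

builds on p205010 (kernel theorem, internal audit signed; external expert review pending)

Seat `prim-rsw3-p1` (gen 3); LANE-4 blueprint, memo `run/shared/lean/prim/rsw3/P1-QM.md` §13.4 step (3).  Helper file; no definitions, no
sorries; every `d`.  Notation of parts V and VIII (`EANN`, `NONUNIQ`, `IDAT`, `ILINK`, `XS = Xs ∪ ∂ⁱⁿΛ(s)`; written out).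
* `exists_eann_crossing_of_explored` — on `IDAT(Xs,Ys)` (lattice; `c + 2 ≤ s`): an explored site `z ∈ XS ∩ Λ(c+1)` is joined inside `XS` to
  a site `u ∈ ∂ⁱⁿΛ(s)` which is the outer end of a crossing of the annulus `Λ(s) ∖ Λ(c+1)` open in `ω ∩ EANN(c+1,s)`;
* **`ilink_of_idat_of_not_nonuniq`** — `IDAT(Xs,Ys) ∖ NONUNIQ(c+1,s) ⊆ ILINK(Xs,Ys)` on lattice configurations: the mirror image of
  `link'_of_dat_of_not_nonuniq` (part VI) for the inward exploration (an `EANN(c+1,s)`-path never visits `Λ(c)`, so from an explored site it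
  stays explored);
* `real_inter_diff_goodIn_le` — for every event `E'`: `P(E' ∖ GOOD_in) ≤ P(E' ∩ NONUNIQ(c+1,s))` (own inward datum).
References: D. Basu, A. Sapozhnikov, ECP 22 (2017) no. 26, §2 (𝒳_j, 𝒴_j, F_j); H. Kesten, PTRF 73 (1986) §2.
-/

noncomputable section

namespace Summit.CriticalPhenomena.PercolationContinuityZ3.Theorems.Crossing

open MeasureTheory Literature.Probability.Percolation Literature.Probability.LatticeModels
open Literature.Probability.Percolation.DCT16
open Summit.CriticalPhenomena.PercolationContinuityZ3.Theorems.SurfaceTension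

variable {d : ℕ}

/-- **An explored site near the inner box hangs on an `EANN(c+1,s)`-crossing.**  On `IDAT(Xs,Ys)` (lattice, `c + 2 ≤ s`,
`Xs ⊆ Λ(s−1) ∖ Λ(c)`), for `z ∈ XS ∩ Λ(c+1)` there are `t ∈ ∂ⁱⁿΛ(c+1)` and `u ∈ ∂ⁱⁿΛ(s)` with `ω ∩ EANN(c+1,s) ∈ openConnIn Λ(s) t u` and
`ω ∈ openConnIn XS u z`. [cite: BasuSapozhnikov2017ECP, §2 (𝒳_j)] -/
theorem exists_eann_crossing_of_explored {c s : ℕ} (hcs : c + 2 ≤ s) {Xs Ys : Finset (Site d)} (hXs : Xs ⊆ box d (s - 1) \ box d c)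
    {ω : BondConfig (Site d)} (hω : ω ⊆ (zdGraph d).edgeSet)
    (hI : ω ∩ (↑((box d s).sym2) : Set (Sym2 (Site d))) ∈
      explEvent ((↑(box d (s - 1)) : Set (Site d))ᶜ) ((↑(box d (s - 1)) : Set (Site d)) \ ↑(box d c))
        ((↑(box d (s - 1)) : Set (Site d))ᶜ ∪ ↑Xs) ↑Ys)
    {z : Site d} (hz : z ∈ Xs ∪ innerBoundary (zdGraph d) (box d s)) (hzc : z ∈ box d (c + 1)) :
    ∃ t ∈ innerBoundary (zdGraph d) (box d (c + 1)), ∃ u ∈ innerBoundary (zdGraph d) (box d s),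
      ω ∩ {e : Sym2 (Site d) | e ∈ (↑((box d s).sym2) : Set (Sym2 (Site d))) ∧
          ¬ (∀ v ∈ e, v ∈ box d (c + 1)) ∧ ¬ (∀ v ∈ e, v ∈ innerBoundary (zdGraph d) (box d s))} ∈
        openConnIn (↑(box d s) : Set (Site d)) t u ∧
      ω ∈ openConnIn (↑(Xs ∪ innerBoundary (zdGraph d) (box d s)) : Set (Site d)) u z := by
  classical
  obtain ⟨hSet, -⟩ := mem_explEvent_iff.1 hI
  set In' : Set (Site d) := (↑(box d (s - 1)) : Set (Site d))ᶜ with hIn'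
  set Blk' : Set (Site d) := (↑(box d (s - 1)) : Set (Site d)) \ ↑(box d c) with hBlk'
  set K : Set (Sym2 (Site d)) := ↑((box d s).sym2) with hK
  have hIB : In' ∪ Blk' = (↑(box d c) : Set (Site d))ᶜ := compl_union_shell hcs
  have hωK : ω ∩ K ⊆ (zdGraph d).edgeSet := fun e he => hω he.1
  -- explored sites of `Λ(s)` are exactly `XS`
  have hXS_of_expl : ∀ v : Site d, v ∈ box d s → v ∈ explSet In' Blk' (ω ∩ K) → v ∈ Xs ∪ innerBoundary (zdGraph d) (box d s) := by
    intro v hvs hv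
    rw [hSet] at hv
    rcases hv with hv | hv
    · exact Finset.mem_union_right _ (mem_innerBoundary_box_of_notMem_pred (by omega) hvs (fun h => hv (Finset.mem_coe.2 h)))
    · exact Finset.mem_union_left _ (Finset.mem_coe.1 hv)
  have hzs1 : z ∈ box d (s - 1) := box_mono d (by omega) hzc
  have hzXs : z ∈ Xs := by
    rcases Finset.mem_union.1 hz with h | h
    · exact h
    · exact absurd hzs1 (notMem_box_of_mem_innerBoundary_box (by omega) h)
  have hzexpl : z ∈ explSet In' Blk' (ω ∩ K) := by rw [hSet]; exact Or.inr (Finset.mem_coe.2 hzXs)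
  obtain ⟨-, u₀, hu₀, hu₀z⟩ := mem_explSet_iff_exists.1 hzexpl
  -- every vertex joined to `u₀` inside `In' ∪ Blk'` (by `ω ∩ K`) is explored
  have hexpl : ∀ v : Site d, ω ∩ K ∈ openConnIn (In' ∪ Blk') u₀ v → v ∈ explSet In' Blk' (ω ∩ K) := fun v h =>
    mem_explSet_of_openConnIn (subset_explSet _ _ _ hu₀) h
  obtain ⟨P, hPS, hPω⟩ := exists_walk_of_mem_openConnIn hωK hu₀z
  have hPexpl : ∀ v ∈ P.support, v ∈ explSet In' Blk' (ω ∩ K) := fun v hv => hexpl v (mem_openConnIn_of_mem_support P hPS hPω hv)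
  -- vertices of `P` other than... all vertices of `P` lie in `Λ(s)` as soon as `P` has an edge; handle via the cut at `Λ(s−1)`
  have hzS : z ∈ (↑(box d (s - 1)) : Set (Site d)) := Finset.mem_coe.2 hzs1
  have hu₀S : u₀ ∉ (↑(box d (s - 1)) : Set (Site d)) := hu₀
  obtain ⟨a₁, u, q, rest, hadj₁, ha₁, hu, hqB, hqP, hrestP, hedges⟩ := exists_cut_walk_edge (↑(box d (s - 1)) : Set (Site d)) P.reverse hzS hu₀S
  have hus : u ∈ box d s := by
    have := mem_box_succ_of_adj_box hadj₁ (Finset.mem_coe.1 ha₁); rwa [Nat.sub_add_cancel (by omega : 1 ≤ s)] at this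
  have huB : u ∈ innerBoundary (zdGraph d) (box d s) := mem_innerBoundary_box_of_notMem_pred (by omega) hus (fun h => hu (Finset.mem_coe.2 h))
  have hPrevω : ∀ e ∈ P.reverse.edges, e ∈ ω ∩ K := fun e he => by
    rw [SimpleGraph.Walk.edges_reverse, List.mem_reverse] at he; exact hPω e he
  have hPrevexpl : ∀ v ∈ P.reverse.support, v ∈ explSet In' Blk' (ω ∩ K) := fun v hv => by
    rw [SimpleGraph.Walk.support_reverse, List.mem_reverse] at hv; exact hPexpl v hv
  -- the walk `W : z → u`, `W = q · (a₁, u)`; its vertices lie in `XS`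
  set W : (zdGraph d).Walk z u := q.concat hadj₁ with hW
  have hWedges : ∀ e ∈ W.edges, e ∈ ω ∩ K := by
    intro e he
    rw [hW, SimpleGraph.Walk.edges_concat, List.concat_eq_append, List.mem_append, List.mem_singleton] at he
    apply hPrevω; rw [hedges]
    rcases he with he | rfl
    · exact List.mem_append_left _ he
    · exact List.mem_append_right _ List.mem_cons_self
  have hWsupp : ∀ v ∈ W.support, v ∈ q.support ∨ v = u := by
    intro v hv
    rw [hW, SimpleGraph.Walk.support_concat, List.mem_append, List.mem_singleton] at hv
    exact hv
  have hWs : ∀ v ∈ W.support, v ∈ box d s := fun v hv =>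
    (hWsupp v hv).elim (fun h => box_mono d (Nat.sub_le s 1) (Finset.mem_coe.1 (hqB v h))) (fun h => h ▸ hus)
  have hWXS : ∀ v ∈ W.support, v ∈ (↑(Xs ∪ innerBoundary (zdGraph d) (box d s)) : Set (Site d)) := by
    intro v hv
    refine Finset.mem_coe.2 (hXS_of_expl v (hWs v hv) ?_)
    rcases hWsupp v hv with h | rfl
    · exact hPrevexpl v (hqP v h)
    · exact hPrevexpl v (hrestP v rest.start_mem_support)
  have huz : ω ∈ openConnIn (↑(Xs ∪ innerBoundary (zdGraph d) (box d s)) : Set (Site d)) u z := by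
    rw [openConnIn_comm]
    exact mem_openConnIn_of_walk W hWXS (fun e he => (hWedges e he).1)
  -- the crossing: last visit of `W` to `Λ(c+1)` = first exit of `W.reverse : u → z` from `Λ(c+1)ᶜ`
  have huC : u ∈ (↑(box d (c + 1)) : Set (Site d))ᶜ := fun h => hu (Finset.mem_coe.2 (box_mono d (by omega) (Finset.mem_coe.1 h)))
  have hzC : z ∉ (↑(box d (c + 1)) : Set (Site d))ᶜ := fun h => h (Finset.mem_coe.2 hzc)
  obtain ⟨a₂, t, q₂, r₂, hadj₂, ha₂, ht, hq₂B, hq₂W, -, hedges₂⟩ := exists_cut_walk_edge ((↑(box d (c + 1)) : Set (Site d))ᶜ) W.reverse huC hzC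
  have htc1 : t ∈ box d (c + 1) := by by_contra h; exact ht (fun h' => h (Finset.mem_coe.1 h'))
  have hWrevs : ∀ v ∈ W.reverse.support, v ∈ box d s := fun v hv => by
    rw [SimpleGraph.Walk.support_reverse, List.mem_reverse] at hv; exact hWs v hv
  have hWrevXS : ∀ v ∈ W.reverse.support, v ∈ Xs ∪ innerBoundary (zdGraph d) (box d s) := fun v hv => by
    rw [SimpleGraph.Walk.support_reverse, List.mem_reverse] at hv; exact Finset.mem_coe.1 (hWXS v hv)
  have hXSc : ∀ v ∈ Xs ∪ innerBoundary (zdGraph d) (box d s), v ∉ box d c := fun v hv h' => by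
    rcases Finset.mem_union.1 hv with h | h
    · exact (Finset.mem_sdiff.1 (hXs h)).2 h'
    · exact notMem_box_of_mem_innerBoundary_box (by omega : c < s) h h'
  have htB : t ∈ innerBoundary (zdGraph d) (box d (c + 1)) := by
    have htW : t ∈ W.reverse.support := by
      have h := W.reverse.edges_subset_edgeSet (by rw [hedges₂]; exact List.mem_append_right _ List.mem_cons_self : s(a₂, t) ∈ W.reverse.edges)
      exact W.reverse.snd_mem_support_of_mem_edges (by rw [hedges₂]; exact List.mem_append_right _ List.mem_cons_self)
    exact mem_innerBoundary_box_of_notMem_pred (by omega) htc1 (by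
      rw [Nat.add_sub_cancel]; exact hXSc t (hWrevXS t htW))
  have hWrevedges : ∀ e ∈ W.reverse.edges, e ∈ ω ∩ K := fun e he => by
    rw [SimpleGraph.Walk.edges_reverse, List.mem_reverse] at he; exact hWedges e he
  refine ⟨t, htB, u, huB, ?_, huz⟩
  rw [openConnIn_comm]
  -- the crossing walk `q₂ · (a₂, t) : u → t`
  have hq₂e : ∀ e ∈ q₂.edges, e ∈ W.reverse.edges := fun e he => by rw [hedges₂]; exact List.mem_append_left _ he
  have he₂ : s(a₂, t) ∈ W.reverse.edges := by rw [hedges₂]; exact List.mem_append_right _ List.mem_cons_self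
  refine mem_openConnIn_of_walk (q₂.concat hadj₂) (fun v hv => ?_) (fun e he => ?_)
  · rw [SimpleGraph.Walk.support_concat, List.mem_append, List.mem_singleton] at hv
    rcases hv with hv | rfl
    · exact Finset.mem_coe.2 (hWrevs v (hq₂W v hv))
    · exact Finset.mem_coe.2 (box_mono d (by omega) htc1)
  · rw [SimpleGraph.Walk.edges_concat, List.concat_eq_append, List.mem_append, List.mem_singleton] at he
    have heW : e ∈ W.reverse.edges := he.elim (hq₂e e) (fun h => h ▸ he₂)
    refine ⟨(hWrevedges e heW).1, (hWrevedges e heW).2, ?_, ?_⟩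
    · -- not inside `Λ(c+1)`: an endpoint lies in `q₂.support ⊆ Λ(c+1)ᶜ`
      intro hall
      rcases he with he | rfl
      · induction e using Sym2.ind with
        | h x y => exact hq₂B x (q₂.fst_mem_support_of_mem_edges he) (Finset.mem_coe.2 (hall x (Sym2.mem_mk_left x y)))
      · exact ha₂ (Finset.mem_coe.2 (hall a₂ (Sym2.mem_mk_left _ _)))
    · -- not inside `∂ⁱⁿΛ(s)`: the two endpoints are distinct vertices of `W`, at most one of which is `u`
      intro hall
      induction e using Sym2.ind with
      | h x y =>
        have hxW : x ∈ W.support := by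
          have := W.reverse.fst_mem_support_of_mem_edges heW
          rwa [SimpleGraph.Walk.support_reverse, List.mem_reverse] at this
        have hyW : y ∈ W.support := by
          have := W.reverse.snd_mem_support_of_mem_edges heW
          rwa [SimpleGraph.Walk.support_reverse, List.mem_reverse] at this
        have hne : x ≠ y := by
          have := W.reverse.edges_subset_edgeSet heW
          rw [SimpleGraph.mem_edgeSet] at this; exact this.ne
        have hx' : x = u := by
          rcases hWsupp x hxW with h | h
          · exact absurd (box_mono d le_rfl (Finset.mem_coe.1 (hqB x h)))
              (notMem_box_of_mem_innerBoundary_box (by omega) (hall x (Sym2.mem_mk_left x y)))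
          · exact h
        have hy' : y = u := by
          rcases hWsupp y hyW with h | h
          · exact absurd (box_mono d le_rfl (Finset.mem_coe.1 (hqB y h)))
              (notMem_box_of_mem_innerBoundary_box (by omega) (hall y (Sym2.mem_mk_right x y)))
          · exact h
        exact hne (hx'.trans hy'.symm)

/-- **`IDAT(Xs,Ys) ∖ NONUNIQ(c+1,s) ⊆ ILINK(Xs,Ys)`** on lattice configurations (`1 ≤ c`, `c + 2 ≤ s`, `Xs ⊆ Λ(s−1) ∖ Λ(c)`): the
`EANN(c+1,s)`-crossings on which two attachment points hang are `EANN`-joined inside `Λ(s)`; an `EANN(c+1,s)`-path never visits `Λ(c)`, so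
from the explored site `u` it runs inside the explored set `XS`. [cite: BasuSapozhnikov2017ECP, §2 (F_j)] -/
theorem ilink_of_idat_of_not_nonuniq {c s : ℕ} (hcs : c + 2 ≤ s) {Xs Ys : Finset (Site d)} (hXs : Xs ⊆ box d (s - 1) \ box d c)
    {ω : BondConfig (Site d)} (hω : ω ⊆ (zdGraph d).edgeSet)
    (hI : ω ∩ (↑((box d s).sym2) : Set (Sym2 (Site d))) ∈
      explEvent ((↑(box d (s - 1)) : Set (Site d))ᶜ) ((↑(box d (s - 1)) : Set (Site d)) \ ↑(box d c))
        ((↑(box d (s - 1)) : Set (Site d))ᶜ ∪ ↑Xs) ↑Ys)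
    (hN : ω ∉ {ω : BondConfig (Site d) | ∃ t₁ ∈ innerBoundary (zdGraph d) (box d (c + 1)), ∃ w₁ ∈ innerBoundary (zdGraph d) (box d s),
        ∃ t₂ ∈ innerBoundary (zdGraph d) (box d (c + 1)), ∃ w₂ ∈ innerBoundary (zdGraph d) (box d s),
        ω ∩ {e : Sym2 (Site d) | e ∈ (↑((box d s).sym2) : Set (Sym2 (Site d))) ∧
            ¬ (∀ v ∈ e, v ∈ box d (c + 1)) ∧ ¬ (∀ v ∈ e, v ∈ innerBoundary (zdGraph d) (box d s))} ∈
          openConnIn (↑(box d s) : Set (Site d)) t₁ w₁ ∧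
        ω ∩ {e : Sym2 (Site d) | e ∈ (↑((box d s).sym2) : Set (Sym2 (Site d))) ∧
            ¬ (∀ v ∈ e, v ∈ box d (c + 1)) ∧ ¬ (∀ v ∈ e, v ∈ innerBoundary (zdGraph d) (box d s))} ∈
          openConnIn (↑(box d s) : Set (Site d)) t₂ w₂ ∧
        ω ∩ {e : Sym2 (Site d) | e ∈ (↑((box d s).sym2) : Set (Sym2 (Site d))) ∧
            ¬ (∀ v ∈ e, v ∈ box d (c + 1)) ∧ ¬ (∀ v ∈ e, v ∈ innerBoundary (zdGraph d) (box d s))} ∉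
          openConnIn (↑(box d s) : Set (Site d)) w₁ w₂}) :
    ω ∈ {ω : BondConfig (Site d) | ∀ y ∈ Ys, ∀ y' ∈ Ys, ∀ z ∈ Xs ∪ innerBoundary (zdGraph d) (box d s),
      ∀ z' ∈ Xs ∪ innerBoundary (zdGraph d) (box d s), s(z, y) ∈ ω → s(z', y') ∈ ω →
      ω ∈ openConnIn (↑(Xs ∪ innerBoundary (zdGraph d) (box d s)) : Set (Site d)) z z'} := by
  classical
  obtain ⟨hSet, -⟩ := mem_explEvent_iff.1 hI
  obtain ⟨hrim, -⟩ := inner_rim_facts hcs hXs hω hI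
  set In' : Set (Site d) := (↑(box d (s - 1)) : Set (Site d))ᶜ with hIn'
  set Blk' : Set (Site d) := (↑(box d (s - 1)) : Set (Site d)) \ ↑(box d c) with hBlk'
  set K : Set (Sym2 (Site d)) := ↑((box d s).sym2) with hK
  have hIB : In' ∪ Blk' = (↑(box d c) : Set (Site d))ᶜ := compl_union_shell hcs
  have hXS_of_expl : ∀ v : Site d, v ∈ box d s → v ∈ explSet In' Blk' (ω ∩ K) → v ∈ Xs ∪ innerBoundary (zdGraph d) (box d s) := by
    intro v hvs hv
    rw [hSet] at hv
    rcases hv with hv | hv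
    · exact Finset.mem_union_right _ (mem_innerBoundary_box_of_notMem_pred (by omega) hvs (fun h => hv (Finset.mem_coe.2 h)))
    · exact Finset.mem_union_left _ (Finset.mem_coe.1 hv)
  have hzc1 : ∀ y ∈ Ys, ∀ z : Site d, s(z, y) ∈ ω → z ∈ box d (c + 1) := by
    intro y hy z hzy
    have hadj : (zdGraph d).Adj z y := by have := hω hzy; rwa [SimpleGraph.mem_edgeSet] at this
    exact mem_box_succ_of_adj_box hadj.symm (Finset.mem_filter.1 (hrim y hy).1).1
  intro y hy y' hy' z hz z' hz' hzy hz'y'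
  obtain ⟨t, ht, u, hu, hcross, huz⟩ := exists_eann_crossing_of_explored hcs hXs hω hI hz (hzc1 y hy z hzy)
  obtain ⟨t', ht', u', hu', hcross', hu'z'⟩ := exists_eann_crossing_of_explored hcs hXs hω hI hz' (hzc1 y' hy' z' hz'y')
  -- the two crossings are EANN-joined
  have hjoin : ω ∩ {e : Sym2 (Site d) | e ∈ (↑((box d s).sym2) : Set (Sym2 (Site d))) ∧
      ¬ (∀ v ∈ e, v ∈ box d (c + 1)) ∧ ¬ (∀ v ∈ e, v ∈ innerBoundary (zdGraph d) (box d s))} ∈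
      openConnIn (↑(box d s) : Set (Site d)) u u' := by
    by_contra h
    exact hN ⟨t, ht, u, hu, t', ht', u', hu', hcross, hcross', h⟩
  have hωE : ω ∩ {e : Sym2 (Site d) | e ∈ (↑((box d s).sym2) : Set (Sym2 (Site d))) ∧
      ¬ (∀ v ∈ e, v ∈ box d (c + 1)) ∧ ¬ (∀ v ∈ e, v ∈ innerBoundary (zdGraph d) (box d s))} ⊆ (zdGraph d).edgeSet :=
    fun e he => hω he.1
  obtain ⟨J, hJS, hJE⟩ := exists_walk_of_mem_openConnIn hωE hjoin
  have huc : u ∉ box d (c + 1 - 1) := by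
    rw [Nat.add_sub_cancel]
    exact fun h => notMem_box_of_mem_innerBoundary_box (by omega : c < s) hu h
  have hJavoid := notMem_box_pred_of_eann_walk (a := c + 1) (b := s) (by omega) J (fun e he => (hJE e he).2) huc
  rw [Nat.add_sub_cancel] at hJavoid
  -- `u` is explored, hence so is every vertex of `J`
  have huexpl : u ∈ explSet In' Blk' (ω ∩ K) :=
    subset_explSet _ _ _ (fun h => notMem_box_of_mem_innerBoundary_box (by omega : s - 1 < s) hu (Finset.mem_coe.1 h))
  have hJIB : ∀ v ∈ J.support, v ∈ In' ∪ Blk' := fun v hv => by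
    rw [hIB]; exact fun h => hJavoid v hv (Finset.mem_coe.1 h)
  have hJK : ∀ e ∈ J.edges, e ∈ ω ∩ K := fun e he => ⟨(hJE e he).1, (hJE e he).2.1⟩
  have hJXS : ∀ v ∈ J.support, v ∈ (↑(Xs ∪ innerBoundary (zdGraph d) (box d s)) : Set (Site d)) := by
    intro v hv
    refine Finset.mem_coe.2 (hXS_of_expl v (Finset.mem_coe.1 (hJS v hv)) ?_)
    exact mem_explSet_of_openConnIn huexpl (mem_openConnIn_of_mem_support J hJIB hJK hv)
  have huu' : ω ∈ openConnIn (↑(Xs ∪ innerBoundary (zdGraph d) (box d s)) : Set (Site d)) u u' :=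
    mem_openConnIn_of_walk J hJXS (fun e he => (hJE e he).1)
  rw [openConnIn_comm] at huz
  exact PlanarDuality.openConnIn_trans (PlanarDuality.openConnIn_trans huz huu') hu'z'

/-- **Outside annulus non-uniqueness every configuration is `GOOD_in`**: for every event `E'` (`1 ≤ c`... `c + 2 ≤ s`),
`P(E' ∖ GOOD_in) ≤ P(E' ∩ NONUNIQ(c+1,s))`, `GOOD_in = ⋃_{(Xs,Ys) ∈ 𝒟_in} IDAT ∩ ILINK` (own inward datum, then
`ilink_of_idat_of_not_nonuniq`). [cite: BasuSapozhnikov2017ECP, §2 (F_j)] -/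
theorem real_inter_diff_goodIn_le (p : unitInterval) {c s : ℕ} (hcs : c + 2 ≤ s) (E' : Set (BondConfig (Site d))) :
    (bondPercolation (zdGraph d) p).real (E' \
        ⋃ I ∈ (box d (s - 1) \ box d c).powerset ×ˢ (innerBoundary (zdGraph d) (box d c)).powerset,
          ({ω : BondConfig (Site d) | ω ∩ (↑((box d s).sym2) : Set (Sym2 (Site d))) ∈
              explEvent ((↑(box d (s - 1)) : Set (Site d))ᶜ) ((↑(box d (s - 1)) : Set (Site d)) \ ↑(box d c))
                ((↑(box d (s - 1)) : Set (Site d))ᶜ ∪ ↑I.1) ↑I.2} ∩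
           {ω : BondConfig (Site d) | ∀ y ∈ I.2, ∀ y' ∈ I.2, ∀ z ∈ I.1 ∪ innerBoundary (zdGraph d) (box d s),
              ∀ z' ∈ I.1 ∪ innerBoundary (zdGraph d) (box d s), s(z, y) ∈ ω → s(z', y') ∈ ω →
              ω ∈ openConnIn (↑(I.1 ∪ innerBoundary (zdGraph d) (box d s)) : Set (Site d)) z z'})) ≤
      (bondPercolation (zdGraph d) p).real (E' ∩
        {ω : BondConfig (Site d) | ∃ t₁ ∈ innerBoundary (zdGraph d) (box d (c + 1)), ∃ w₁ ∈ innerBoundary (zdGraph d) (box d s),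
          ∃ t₂ ∈ innerBoundary (zdGraph d) (box d (c + 1)), ∃ w₂ ∈ innerBoundary (zdGraph d) (box d s),
          ω ∩ {e : Sym2 (Site d) | e ∈ (↑((box d s).sym2) : Set (Sym2 (Site d))) ∧
              ¬ (∀ v ∈ e, v ∈ box d (c + 1)) ∧ ¬ (∀ v ∈ e, v ∈ innerBoundary (zdGraph d) (box d s))} ∈
            openConnIn (↑(box d s) : Set (Site d)) t₁ w₁ ∧
          ω ∩ {e : Sym2 (Site d) | e ∈ (↑((box d s).sym2) : Set (Sym2 (Site d))) ∧
              ¬ (∀ v ∈ e, v ∈ box d (c + 1)) ∧ ¬ (∀ v ∈ e, v ∈ innerBoundary (zdGraph d) (box d s))} ∈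
            openConnIn (↑(box d s) : Set (Site d)) t₂ w₂ ∧
          ω ∩ {e : Sym2 (Site d) | e ∈ (↑((box d s).sym2) : Set (Sym2 (Site d))) ∧
              ¬ (∀ v ∈ e, v ∈ box d (c + 1)) ∧ ¬ (∀ v ∈ e, v ∈ innerBoundary (zdGraph d) (box d s))} ∉
            openConnIn (↑(box d s) : Set (Site d)) w₁ w₂}) := by
  classical
  refine real_mono_of_forall_subset_edgeSet (zdGraph d) p fun ω hω hωE => ?_
  obtain ⟨hE', hG⟩ := hωE
  refine ⟨hE', ?_⟩
  by_contra hN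
  apply hG
  set In' : Set (Site d) := (↑(box d (s - 1)) : Set (Site d))ᶜ with hIn'
  set Blk' : Set (Site d) := (↑(box d (s - 1)) : Set (Site d)) \ ↑(box d c) with hBlk'
  set K : Set (Sym2 (Site d)) := ↑((box d s).sym2) with hK
  have hIB : In' ∪ Blk' = (↑(box d c) : Set (Site d))ᶜ := compl_union_shell hcs
  -- the own inward datum
  set Xs₀ : Finset (Site d) := (box d (s - 1) \ box d c).filter (fun v => v ∈ explSet In' Blk' (ω ∩ K)) with hXs₀
  set Ys₀ : Finset (Site d) := (innerBoundary (zdGraph d) (box d c)).filter (fun v => v ∈ explRim In' Blk' (ω ∩ K)) with hYs₀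
  have hXs₀sub : Xs₀ ⊆ box d (s - 1) \ box d c := Finset.filter_subset _ _
  have hSet : explSet In' Blk' (ω ∩ K) = In' ∪ ↑Xs₀ := by
    ext v
    constructor
    · intro hv
      rcases explSet_subset In' Blk' _ hv with h | h
      · exact Or.inl h
      · refine Or.inr (Finset.mem_coe.2 (Finset.mem_filter.2 ⟨?_, hv⟩))
        exact Finset.mem_sdiff.2 ⟨Finset.mem_coe.1 h.1, fun h' => h.2 (Finset.mem_coe.2 h')⟩
    · rintro (h | h)
      · exact subset_explSet _ _ _ h
      · exact (Finset.mem_filter.1 (Finset.mem_coe.1 h)).2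
  have hRim : explRim In' Blk' (ω ∩ K) = ↑Ys₀ := by
    ext w
    constructor
    · intro hw
      obtain ⟨hwU, v, hv, hvw⟩ := mem_explRim_iff.1 hw
      have hwc : w ∈ box d c := by
        by_contra h
        have hw' : w ∈ In' ∪ Blk' := by rw [hIB]; exact fun h' => h (Finset.mem_coe.1 h')
        rcases hw' with hw' | hw'
        · exact hwU (subset_explSet _ _ _ hw')
        · exact hwU (mem_explSet_of_open_edge hv hvw (Or.inr hw'))
      have hvc : v ∉ box d c := by
        have := explSet_subset In' Blk' _ hv
        rw [hIB] at this
        exact fun h => this (Finset.mem_coe.2 h)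
      have hadj : (zdGraph d).Adj v w := by have := hω hvw.1; rwa [SimpleGraph.mem_edgeSet] at this
      exact Finset.mem_coe.2 (Finset.mem_filter.2 ⟨mem_innerBoundary_iff.2 ⟨hwc, v, hvc, hadj.symm⟩, hw⟩)
    · intro h
      exact (Finset.mem_filter.1 (Finset.mem_coe.1 h)).2
  have hI : ω ∩ K ∈ explEvent In' Blk' (In' ∪ ↑Xs₀) ↑Ys₀ := mem_explEvent_iff.2 ⟨hSet, hRim⟩
  simp only [Set.mem_iUnion, Set.mem_inter_iff, exists_prop]
  refine ⟨(Xs₀, Ys₀), ?_, hI, ilink_of_idat_of_not_nonuniq hcs hXs₀sub hω hI hN⟩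
  rw [Finset.mem_product, Finset.mem_powerset, Finset.mem_powerset]
  exact ⟨hXs₀sub, Finset.filter_subset _ _⟩

end Summit.CriticalPhenomena.PercolationContinuityZ3.Theorems.Crossing

end
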